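import Literature.ModelTheory.ExponentialFields.DefinableAlgebraicNumbersProofs
import Literature.NumberTheory.Transcendental.ZilberFieldAutomorphisms
import Literature.NumberTheory.Transcendental.GammaIsoAlgebraicStep
import Literature.NumberTheory.Transcendental.ZilberClosedClassOver
import Literature.NumberTheory.Transcendental.EclClosedSubfieldSEAC
import HarnessLib

/-!
# KMO 2012, Theorem 2 (automorphism form) for countable Zilber fields and for Zilber fields in `Type`

J. Kirby, A. Macintyre, A. Onshuus, *The algebraic numbers definable in various exponential
fields*, J. Inst. Math. Jussieu 11 (2012) 825–834 (arXiv:1101.4224), §3.5 (Proposition), §3.7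
(proof of Theorem 2), §3.8.

Second PROOF file of `DefinableAlgebraicNumbers.lean` (after `DefinableAlgebraicNumbersProofs.lean`,
which deduces the named fact `KMO2012_exists_equiv_apply_ne` — every algebraic number of a Zilber
field which is not real abelian is moved by an automorphism of the exponential field — from the
§3.5 Proposition `KMO2012_automorphismExtension`, as printed). Here the automorphism form of
Theorem 2 is proved OUTRIGHT in the cases the tree's proof of Zilber's categoricity theorem
reaches, following the printed proof of §3.7 with the §3.5 Proposition replaced by its proved
Γ-field form:

* `KMO2012.exists_equiv_apply_ne_of_countable` — **countable Zilber fields, every universe**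
  (KMO §3.5: "In particular, the statement holds for any countable Zilber field"; engine:
  `ZilberAutomorphisms.exists_equiv_of_isGammaIsoTw₂_of_countable`, Kirby 2010 Thm 2.1 /
  Bays–Kirby 2018 Lemma 8.3). Case `α ∈ ℚ^{ab}`: KMO's `σ₁ : τ ↦ -τ` on `SK` is the restriction
  of a field automorphism of `F` inverting the roots of unity (`exists_isEBaseIso₂_of_ringEquiv`),
  `SK ◁ F` by the Schanuel property, and the extension moves `α ∉ ℚ^{abℝ}`
  (`isRealAbelian_of_apply_eq`). Case `α ∉ ℚ^{ab}`: Galois conjugation `α ↦ α'` over `SK` is a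
  Γ-isomorphism `(α) ↦ (α')` over `ℚτ` between strong hulls (`isGammaIso_single_of_ringEquiv`:
  `exp (α/M!)` is transcendental over `SK(α)`, Bays–Kirby 2018 §4.4), which extends.
* `KMO2012.exists_equiv_extend_eclEmpty₀` — **automorphisms of the prime model `ecl(∅)` of an
  uncountable Zilber field in `Type` extend to the field** (the uncountable case of the §3.5
  Proposition for `F₀ ⊆ ecl(∅)`): two base points `incl`, `incl ∘ θ` make `K` two uncountable
  members of the quasiminimal pregeometry class `ZilberClosedClassOver (ecl ∅)` of the tree's
  categoricity proof, which are isomorphic over the base points (Kirby 2010 Thm 3.3 /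
  Haykazyan 2016 Thm 16, `IsQuasiminimalPregeometryClass.nonempty_equiv_of_mk_eq'`).
* `KMO2012.exists_equiv_apply_ne_of_extend_eclEmpty` — the fact in universe `u` from the
  extension property of prime-model automorphisms of uncountable Zilber fields in `Type u`
  (uncountable `F`: move `α` inside the countable Zilber field `ecl^F(∅)` and extend).
* `KMO2012_exists_equiv_apply_ne_of_type_zero : KMO2012_exists_equiv_apply_ne.{0}` — **the named
  fact for all Zilber fields in `Type`, proved**, and its consequence for `ℂ_exp` under Zilber's
  conjecture (`KMO2012.complex_of_isZilberField`).

What is NOT here: the fact in universes `u > 0` for uncountable fields (the class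
`ZilberClosedClassOver` and its language are indexed by pointed E-fields in `Type`; the
extension property `exists_equiv_extend_eclEmpty₀` is proved for `K : Type` only). No named fact
is introduced.

## References

* J. Kirby, A. Macintyre, A. Onshuus, J. Inst. Math. Jussieu 11 (2012) 825–834, arXiv:1101.4224:
  §2.1, §3.5 Proposition, §3.7, §3.8.
* J. Kirby, *On quasiminimal excellent classes*, J. Symbolic Logic 75 (2010) 551–564: Thm 2.1,
  Thm 3.3.
* M. Bays, J. Kirby, Algebra & Number Theory 12 (2018) 493–549: §4.4, Lemma 8.3, Thm 9.1.
* L. Haykazyan, J. Symbolic Logic 81 (2016) 56–64: Thm 16.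
-/

noncomputable section

open scoped Cardinal
open Set

universe u

namespace Literature.ModelTheory.ExponentialFields

open Literature.NumberTheory.Transcendental

namespace KMO2012

/-! ### Elementary lemmas on kernel generators, roots of unity and algebraic numbers -/

section Elementary

open Literature.ModelTheory.ExponentialFields.ExponentialRing
  Literature.NumberTheory.Transcendental.GammaField

variable {F : Type u} [Field F] [CharZero F] [ExponentialRing F]

omit [ExponentialRing F] in
/-- Algebraic numbers lie in `acl s` for every `s`. [folklore] -/
theorem mem_acl_of_isAlgebraic {a : F} (ha : IsAlgebraic ℚ a) (s : Set F) : a ∈ acl s := by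
  rw [mem_acl_iff]
  exact ha.extendScalars (algebraMap ℚ (Algebra.adjoin ℚ s)).injective

omit [ExponentialRing F] in
/-- A nonzero algebraic number is not a rational multiple of a transcendental `τ`. [folklore] -/
theorem not_mem_span_singleton_of_isAlgebraic {τ a : F} (hτ : Transcendental ℚ τ)
    (ha : IsAlgebraic ℚ a) (ha0 : a ≠ 0) : a ∉ Submodule.span ℚ ({τ} : Set F) := by
  intro h
  obtain ⟨q, rfl⟩ := Submodule.mem_span_singleton.1 h
  rcases eq_or_ne q 0 with rfl | hq
  · exact ha0 (zero_smul ℚ τ)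
  · apply hτ
    have e : τ = q⁻¹ • (q • τ) := by rw [smul_smul, inv_mul_cancel₀ hq, one_smul]
    rw [e]
    exact (IsIntegral.smul q⁻¹ (isAlgebraic_iff_isIntegral.1 ha)).isAlgebraic

/-- Algebraic numbers lie in `ecl ∅` (the closure is relatively algebraically closed,
`Khovanskii.mem_ecl_of_isRoot`). [cite: Kirby2010, §7 (proof of Prop. 7.1)] -/
theorem mem_ecl_empty_of_isAlgebraic {a : F} (ha : IsAlgebraic ℚ a) : a ∈ ecl (∅ : Set F) := by
  set p := minpoly ℚ a with hp
  have hp0 : p ≠ 0 := minpoly.ne_zero ha.isIntegral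
  refine Khovanskii.mem_ecl_of_isRoot (p := p.map (algebraMap ℚ F)) ?_ (fun n => ?_) ?_
  · exact Polynomial.map_ne_zero hp0
  · rw [Polynomial.coeff_map]
    exact SubfieldClass.ratCast_mem (Khovanskii.eclSubfield (∅ : Set F)) (p.coeff n)
  · rw [Polynomial.IsRoot, Polynomial.eval_map, ← Polynomial.aeval_def]
    exact minpoly.aeval ℚ a

/-- In an exponential field with kernel `τℤ` and surjective exponential, every root of unity is
`exp (q • τ)` for some rational `q` (KMO §2.1: "the roots of unity are the `exp (jτ/n)`").
[cite: KirbyMacintyreOnshuus2012, §2.1] -/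
theorem exists_exp_smul_eq_of_pow_eq_one {τ : F} (hker : expKernel F = AddSubgroup.zmultiples τ)
    (hsurj : IsSurjectiveOntoUnits F) {ζ : F} {n : ℕ} (hn : 0 < n) (hζ : ζ ^ n = 1) :
    ∃ q : ℚ, exp (q • τ) = ζ := by
  have hζ0 : ζ ≠ 0 := by
    rintro rfl
    rw [zero_pow hn.ne'] at hζ
    exact zero_ne_one hζ
  obtain ⟨z, hz⟩ := hsurj ζ hζ0
  have hnz : ∃ m : ℤ, m • τ = n • z := by
    rw [← AddSubgroup.mem_zmultiples_iff, ← hker, mem_expKernel_iff, exp_nsmul, hz, hζ]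
  obtain ⟨m, hm⟩ := hnz
  refine ⟨(n : ℚ)⁻¹ * m, ?_⟩
  rw [← hz]
  congr 1
  have hn0 : (n : ℚ) ≠ 0 := Nat.cast_ne_zero.2 hn.ne'
  have h1 : (n : ℚ) • z = (m : ℚ) • τ := by
    rw [Nat.cast_smul_eq_nsmul, Int.cast_smul_eq_zsmul, hm]
  rw [mul_smul, ← h1, smul_smul, inv_mul_cancel₀ hn0, one_smul]

/-- The roots of unity lie in `SK = ℚ(ℚτ, exp ℚτ)` (the Γ-subfield of the base `ℚτ`).
[cite: KirbyMacintyreOnshuus2012, §2.1 and §3.1] -/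
theorem adjoin_rootsOfUnity_le_fieldOf {τ : F} (hker : expKernel F = AddSubgroup.zmultiples τ)
    (hsurj : IsSurjectiveOntoUnits F) :
    IntermediateField.adjoin ℚ {ζ : F | ∃ n : ℕ, 0 < n ∧ ζ ^ n = 1} ≤
      fieldOf (Submodule.span ℚ ({τ} : Set F)) := by
  refine IntermediateField.adjoin_le_iff.2 ?_
  rintro ζ ⟨n, hn, hζ⟩
  obtain ⟨q, hq⟩ := exists_exp_smul_eq_of_pow_eq_one hker hsurj hn hζ
  rw [← hq]
  exact exp_mem_fieldOf (Submodule.smul_mem _ q (Submodule.subset_span (mem_singleton τ)))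

/-- A field automorphism `φ` with `φ τ ∈ ℚτ` and `φ (exp qτ) = exp (q φ τ)` maps the generators
`ℚτ ∪ exp ℚτ` of `SK` into themselves. [folklore] -/
theorem mapsTo_gens_span_singleton {τ : F} (φ : F ≃+* F)
    (hφτ : φ τ ∈ Submodule.span ℚ ({τ} : Set F))
    (hφexp : ∀ q : ℚ, φ (exp (q • τ)) = exp (q • φ τ)) :
    MapsTo φ (gens (Submodule.span ℚ ({τ} : Set F))) (gens (Submodule.span ℚ ({τ} : Set F))) := by
  rintro g (hg | ⟨x, hx, rfl⟩)
  · obtain ⟨q, rfl⟩ := Submodule.mem_span_singleton.1 hg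
    left
    show φ (q • τ) ∈ Submodule.span ℚ ({τ} : Set F)
    rw [map_rat_smul]
    exact Submodule.smul_mem _ q hφτ
  · obtain ⟨q, rfl⟩ := Submodule.mem_span_singleton.1 hx
    right
    exact ⟨q • φ τ, Submodule.smul_mem _ q hφτ, (hφexp q).symm⟩

/-- **Restricting a field automorphism to `SK`.** A field automorphism `ψ` of `F` with
`ψ τ = ± τ` and `ψ (exp qτ) = exp (q ψ τ)` (`q ∈ ℚ`) restricts to an isomorphism `σ₀` of the base
Γ-field `SK = ℚ(ℚτ, exp ℚτ)` onto itself which maps `ℚτ` onto `ℚτ` and commutes with `exp` there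
(KMO §3.7: `σ₁`, "defined by `σ₁(2πi) = -2πi`"). [cite: KirbyMacintyreOnshuus2012, §3.7] -/
theorem exists_isEBaseIso₂_of_ringEquiv {τ : F} (ψ : F ≃+* F) (hψτ : ψ τ = τ ∨ ψ τ = -τ)
    (hψexp : ∀ q : ℚ, ψ (exp (q • τ)) = exp (q • ψ τ)) :
    ∃ σ₀ : fieldOf (Submodule.span ℚ ({τ} : Set F)) ≃+* fieldOf (Submodule.span ℚ ({τ} : Set F)),
      IsEBaseIso₂ (Submodule.span ℚ ({τ} : Set F)) (Submodule.span ℚ ({τ} : Set F)) σ₀ ∧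
        ∀ x : fieldOf (Submodule.span ℚ ({τ} : Set F)), (σ₀ x : F) = ψ x := by
  set D : Submodule ℚ F := Submodule.span ℚ ({τ} : Set F) with hDdef
  have hτD : τ ∈ D := Submodule.subset_span (mem_singleton τ)
  have hψτD : ψ τ ∈ D := by
    rcases hψτ with h | h
    · rw [h]; exact hτD
    · rw [h]; exact D.neg_mem hτD
  -- the same hypotheses for `ψ⁻¹`
  have hψsymmτ : ψ.symm τ = τ ∨ ψ.symm τ = -τ := by
    rcases hψτ with h1 | h1
    · left
      conv_lhs => rw [← h1]
      exact ψ.symm_apply_apply τ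
    · right
      have h2 : ψ (-τ) = τ := by rw [map_neg, h1, neg_neg]
      conv_lhs => rw [← h2]
      exact ψ.symm_apply_apply (-τ)
  have hψsymmτD : ψ.symm τ ∈ D := by
    rcases hψsymmτ with h | h
    · rw [h]; exact hτD
    · rw [h]; exact D.neg_mem hτD
  have hψsymmexp : ∀ q : ℚ, ψ.symm (exp (q • τ)) = exp (q • ψ.symm τ) := by
    intro q
    apply ψ.injective
    rw [ψ.apply_symm_apply]
    rcases hψτ with h1 | h1
    · have h2 : ψ.symm τ = τ := by
        conv_lhs => rw [← h1]
        exact ψ.symm_apply_apply τ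
      rw [h2, hψexp, h1]
    · have h2 : ψ.symm τ = -τ := by
        have h3 : ψ (-τ) = τ := by rw [map_neg, h1, neg_neg]
        conv_lhs => rw [← h3]
        exact ψ.symm_apply_apply (-τ)
      rw [h2, smul_neg, ← neg_smul, hψexp, h1, smul_neg, neg_smul, neg_neg]
  have hG : ψ '' gens D = gens D := by
    refine Subset.antisymm (mapsTo_gens_span_singleton ψ hψτD hψexp).image_subset fun g hg => ?_
    exact ⟨ψ.symm g, mapsTo_gens_span_singleton ψ.symm hψsymmτD hψsymmexp hg,
      ψ.apply_symm_apply g⟩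
  let ψₐ : F ≃ₐ[ℚ] F := AlgEquiv.ofRingEquiv (f := ψ) fun q => by simp
  have hmap : (fieldOf D).map ψₐ.toAlgHom = fieldOf D := by
    rw [fieldOf, IntermediateField.adjoin_map]
    congr 1
  let σₐ : fieldOf D ≃ₐ[ℚ] fieldOf D :=
    (IntermediateField.intermediateFieldMap ψₐ (fieldOf D)).trans (IntermediateField.equivOfEq hmap)
  have hσ : ∀ x : fieldOf D, ((σₐ x : fieldOf D) : F) = ψ x := fun x => rfl
  have hσsymm : ∀ y : fieldOf D, ((σₐ.symm y : fieldOf D) : F) = ψ.symm y := by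
    intro y
    apply ψ.injective
    rw [ψ.apply_symm_apply, ← hσ, AlgEquiv.apply_symm_apply]
  refine ⟨σₐ.toRingEquiv, ⟨fun {x} hx => ?_, fun {y} hy => ?_, fun {x} hx => ?_⟩, fun x => hσ x⟩
  · change ((σₐ _ : fieldOf D) : F) ∈ D
    rw [hσ]
    obtain ⟨q, rfl⟩ := Submodule.mem_span_singleton.1 hx
    show ψ (q • τ) ∈ D
    rw [map_rat_smul]
    exact D.smul_mem q hψτD
  · change ((σₐ.symm _ : fieldOf D) : F) ∈ D
    rw [hσsymm]
    obtain ⟨q, rfl⟩ := Submodule.mem_span_singleton.1 hy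
    show ψ.symm (q • τ) ∈ D
    rw [map_rat_smul]
    exact D.smul_mem q hψsymmτD
  · change ((σₐ _ : fieldOf D) : F) = exp ((σₐ _ : fieldOf D) : F)
    rw [hσ, hσ]
    obtain ⟨q, rfl⟩ := Submodule.mem_span_singleton.1 hx
    show ψ (exp (q • τ)) = exp (ψ (q • τ))
    rw [map_rat_smul, hψexp]

end Elementary

/-! ### Galois conjugation of an algebraic point as a Γ-isomorphism over `SK` -/

section Conjugate

open Literature.ModelTheory.ExponentialFields.ExponentialRing
  Literature.NumberTheory.Transcendental.GammaField

variable {F : Type u} [Field F] [CharZero F] [ExponentialRing F]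

omit [Field F] [CharZero F] [ExponentialRing F] in
/-- The tuple `(a)` as `Fin.append Fin.elim0 ![a]` has range `{a}`. [folklore] -/
theorem range_append_elim0_single (a : F) :
    range (Fin.append (Fin.elim0 : Fin 0 → F) ![a]) = {a} := by
  rw [ZilberHomogeneity.range_append, Set.range_eq_empty, Set.empty_union, Matrix.range_cons,
    Matrix.range_empty, Set.union_empty]

omit [CharZero F] in
/-- There are no division points of the empty tuple. [folklore] -/
theorem allGens_elim0 : allGens (Fin.elim0 : Fin 0 → F) = ∅ := by
  rw [allGens, Set.iUnion_eq_empty]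
  exact fun M => Set.range_eq_empty _

/-- **Galois conjugation over `SK` is a Γ-isomorphism** (the Γ-form of KMO §3.7, Case
`α ∉ ℚ^{ab}`: "there is an automorphism `σ₂` of `F₀ = SK(α)` which fixes `SK` pointwise, but does
not fix `α` … `F₀ ◁ F`"). Let `F` have the Schanuel property, `τ` a transcendental element with
`exp τ = 1`, `ψ` a field automorphism of `F` fixing `SK = ℚ(ℚτ, exp ℚτ)` pointwise and `a ≠ 0`
algebraic. Then `(a) ↦ (ψ a)` is a Γ-isomorphism over the base `ℚτ`: at every level `M` the
polynomial relations of `(a, exp (a/M!))` over `SK` are generated by the minimal polynomial of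
`a` over `SK`, because `exp (a/M!)` is transcendental over `SK(a)` (`ℚτ ◁ F` by the Schanuel
property), and likewise for the conjugate `ψ a` (Bays–Kirby 2018, §4.4, algebraic step:
`GammaField.IsGammaIso.append_single_of_minpoly`).
[cite: KirbyMacintyreOnshuus2012, §3.7] [cite: BaysKirby2018ANT, §4.4 (Thm 4.17, proof)] -/
theorem isGammaIso_single_of_ringEquiv (hSP : SchanuelProperty F) {τ : F}
    (hτ : Transcendental ℚ τ) (hexpτ : exp τ = 1) (ψ : F ≃+* F)
    (hψ : ∀ x : fieldOf (Submodule.span ℚ ({τ} : Set F)), ψ x = x)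
    {a : F} (ha : IsAlgebraic ℚ a) (ha0 : a ≠ 0) :
    IsGammaIso (Submodule.span ℚ ({τ} : Set F)) (Fin.append (Fin.elim0 : Fin 0 → F) ![a])
      (Fin.append (Fin.elim0 : Fin 0 → F) ![ψ a]) := by
  classical
  set D : Submodule ℚ F := Submodule.span ℚ ({τ} : Set F) with hDdef
  have hsD : IsStrong D :=
    isStrong_span_kernelGenerator_of_isStrong_bot hτ hexpτ (ZilberHomogeneity.isStrong_bot_of_schanuelProperty hSP)
  have hΛ : D ⊔ Submodule.span ℚ (range (Fin.elim0 : Fin 0 → F)) = D := by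
    rw [Set.range_eq_empty, Submodule.span_empty, sup_bot_eq]
  have h0 : IsGammaIso D (Fin.elim0 : Fin 0 → F) (Fin.elim0 : Fin 0 → F) := IsGammaIso.refl D _
  set E := IntermediateField.adjoin (fieldOf D) (allGens (Fin.elim0 : Fin 0 → F)) with hE
  -- every element of `E = SK` is fixed by `ψ` and by `θ = h0.fieldEquiv`
  have hEbot : ∀ e : E, ∃ k : fieldOf D, (k : F) = e := by
    intro e
    have he : (e : F) ∈ IntermediateField.adjoin (fieldOf D) (allGens (Fin.elim0 : Fin 0 → F)) := e.2
    rw [allGens_elim0, IntermediateField.adjoin_empty, IntermediateField.mem_bot] at he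
    obtain ⟨k, hk⟩ := he
    exact ⟨k, hk⟩
  have hcomp : (algebraMap E F).comp h0.fieldEquiv.toRingHom = (ψ : F →+* F).comp (algebraMap E F) := by
    refine RingHom.ext fun e => ?_
    obtain ⟨k, hk⟩ := hEbot e
    have he : e = ⟨k, (IntermediateField.adjoin (fieldOf D) (allGens (Fin.elim0 : Fin 0 → F))).algebraMap_mem k⟩ :=
      Subtype.ext hk.symm
    rw [RingHom.comp_apply, RingHom.comp_apply, he]
    change (h0.fieldEquiv ⟨k, _⟩ : F) = ψ (k : F)
    rw [h0.coe_fieldEquiv_algebraMap k, hψ k]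
  have ha' : IsAlgebraic ℚ (ψ a) := by
    let ψₐ : F ≃ₐ[ℚ] F := AlgEquiv.ofRingEquiv (f := ψ) fun q => by simp
    exact ha.algHom ψₐ.toAlgHom
  have ha0' : ψ a ≠ 0 := (map_ne_zero_iff ψ ψ.injective).2 ha0
  refine h0.append_single_of_minpoly (ha.isIntegral.tower_top) ?_ ?_ ?_
  · rw [hcomp, show ψ a = (ψ : F →+* F) a from rfl, ← Polynomial.hom_eval₂, ← Polynomial.aeval_def,
      minpoly.aeval, map_zero]
  · rw [hΛ]
    exact exp_not_mem_acl_of_mem_acl hsD (mem_acl_of_isAlgebraic ha _)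
      (not_mem_span_singleton_of_isAlgebraic hτ ha ha0)
  · rw [hΛ]
    exact exp_not_mem_acl_of_mem_acl hsD (mem_acl_of_isAlgebraic ha' _)
      (not_mem_span_singleton_of_isAlgebraic hτ ha' ha0')

end Conjugate

/-! ### KMO §3.7 for countable Zilber fields -/

section CountableCase

open Literature.ModelTheory.ExponentialFields.ExponentialRing
  Literature.NumberTheory.Transcendental.GammaField
  Literature.NumberTheory.Transcendental.ZilberAutomorphisms
  Literature.NumberTheory.Transcendental.ZilberPrimeModel

variable {F : Type u} [Field F] [CharZero F] [ExponentialRing F]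

/-- **KMO 2012, Theorem 2 (automorphism form, §3.7) for countable Zilber fields — proved.** In a
countable Zilber field every algebraic number which is not real abelian is moved by some
automorphism of the exponential field. The printed proof (§3.7), with the §3.5 Proposition in
the countable case ("In particular, the statement holds for any countable Zilber field", from
Kirby 2013 / Kirby 2010 Thm 2.1), here `ZilberAutomorphisms.exists_equiv_of_isGammaIsoTw₂_of_countable`:

* `α ∈ ℚ(U)`: a field automorphism `ψ` of `F` with `ψ τ = -τ` inverting the roots of unity
  (`exists_algEquiv_apply_eq_inv`, `exists_ringEquiv_extend`) restricts to KMO's `σ₁` on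
  `SK = ℚ(ℚτ, exp ℚτ)` (`exists_isEBaseIso₂_of_ringEquiv`); `SK ◁ F` by the Schanuel property;
  the extension `ρ` of `σ₁` to the exponential field moves `α`, for otherwise
  `α ∈ Fix(σ₀) ∩ ℚ(U) ⊆ ℚ^{abℝ}` (`isRealAbelian_of_apply_eq`).
* `α ∉ ℚ(U)`: an automorphism of `ℚ̄_F` over `ℚ(U)` moving `α` (`exists_algEquiv_apply_ne`),
  extended to `F` fixing `τ`, fixes `SK` pointwise; `(α) ↦ (ψ α)` is a Γ-isomorphism over `ℚτ`
  between strong hulls (`isGammaIso_single_of_ringEquiv`), which extends to an automorphism of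
  the exponential field.
[cite: KirbyMacintyreOnshuus2012, §3.7 (proof of Theorem 2) and §3.5 Proposition] -/
theorem exists_equiv_apply_ne_of_countable [Countable F] (hF : IsZilberField F) {a : F}
    (ha : IsAlgebraic ℚ a) (hna : ¬ IsRealAbelian a) : ∃ σ : ExponentialRingEquiv F F, σ a ≠ a := by
  classical
  haveI : IsAlgClosed F := hF.isAlgClosed
  obtain ⟨τ, hτ, hker⟩ := hF.hasStandardKernel
  have hτ0 : τ ≠ 0 := fun h0 => hτ (h0 ▸ isAlgebraic_zero)
  have hexpτ : exp τ = 1 := exp_eq_one_of_expKernel hker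
  set D : Submodule ℚ F := Submodule.span ℚ ({τ} : Set F) with hDdef
  have hsD : IsStrong D :=
    isStrong_span_kernelGenerator_of_isStrong_bot hτ hexpτ
      (ZilberHomogeneity.isStrong_bot_of_schanuelProperty hF.schanuelProperty)
  have hΛ : D ⊔ Submodule.span ℚ (range (Fin.elim0 : Fin 0 → F)) = D := by
    rw [Set.range_eq_empty, Submodule.span_empty, sup_bot_eq]
  -- roots of unity are algebraic, and `exp (q • τ)` is one
  have hUalg : ∀ (ζ : F) (n : ℕ), 0 < n → ζ ^ n = 1 → ζ ∈ algebraicClosure ℚ F :=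
    fun ζ n hn hζ => (mem_algebraicClosure_iff).2
      (IsIntegral.of_pow hn (by rw [hζ]; exact isIntegral_one)).isAlgebraic
  by_cases haU : a ∈ IntermediateField.adjoin ℚ {ζ : F | ∃ n : ℕ, 0 < n ∧ ζ ^ n = 1}
  · -- Case `a ∈ ℚ(U)`: extend `σ₁ : τ ↦ -τ`
    obtain ⟨σ₀', hσ₀'⟩ := exists_algEquiv_apply_eq_inv (F := F)
    obtain ⟨ψ, hψE, hψτ⟩ := exists_ringEquiv_extend σ₀' hτ (ε := -1) (by norm_num)
    have hψτ' : ψ τ = -τ := by rw [hψτ, map_neg, map_one, neg_one_mul]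
    have hψU : ∀ (ζ : F) (n : ℕ), 0 < n → ζ ^ n = 1 → ψ ζ = ζ⁻¹ := by
      intro ζ n hn hζ
      have h1 := hψE ⟨ζ, hUalg ζ n hn hζ⟩
      have h2 : (⟨ζ, hUalg ζ n hn hζ⟩ : algebraicClosure ℚ F) ^ n = 1 := Subtype.ext (by
        rw [SubmonoidClass.coe_pow]; exact hζ)
      rw [show ψ ζ = ψ ((⟨ζ, hUalg ζ n hn hζ⟩ : algebraicClosure ℚ F) : F) from rfl, h1,
        hσ₀' _ n hn h2]
      rfl
    have hψexp : ∀ q : ℚ, ψ (exp (q • τ)) = exp (q • ψ τ) := fun q => by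
      rw [hψτ', smul_neg, exp_neg_eq_inv]
      exact hψU _ q.den q.den_pos (exp_smul_pow_den hexpτ q)
    obtain ⟨σ₀, hσ₀, hσ₀ψ⟩ := exists_isEBaseIso₂_of_ringEquiv ψ (Or.inr hψτ') hψexp
    have hs : IsStrong (D ⊔ Submodule.span ℚ (range (Fin.elim0 : Fin 0 → F))) := by rwa [hΛ]
    obtain ⟨ρ, -, hρ⟩ := exists_equiv_of_isGammaIsoTw₂_of_countable hF hker hker hτ0 hτ0 hσ₀
      (isGammaIsoTw₂_elim0 σ₀) hs hs
    have haSK : a ∈ fieldOf D := adjoin_rootsOfUnity_le_fieldOf hker hF.isSurjectiveOntoUnits haU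
    refine ⟨ρ, fun hfix => hna ?_⟩
    have h1 : ψ a = a := by
      rw [← hσ₀ψ ⟨a, haSK⟩, ← hρ ⟨a, haSK⟩]
      exact hfix
    exact isRealAbelian_of_apply_eq (ψ : F →+* F) hψU haU h1
  · -- Case `a ∉ ℚ(U)`: Galois conjugation over `SK` as a Γ-isomorphism
    have ha' : a ∈ algebraicClosure ℚ F := (mem_algebraicClosure_iff).2 ha
    have haU' : (⟨a, ha'⟩ : algebraicClosure ℚ F) ∉ IntermediateField.adjoin ℚ
        {ζ : algebraicClosure ℚ F | ∃ n : ℕ, 0 < n ∧ ζ ^ n = 1} := by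
      intro hmem
      apply haU
      let ι : algebraicClosure ℚ F →ₐ[ℚ] F := (algebraMap (algebraicClosure ℚ F) F).toRatAlgHom
      have h1 : a ∈ (IntermediateField.adjoin ℚ
          {ζ : algebraicClosure ℚ F | ∃ n : ℕ, 0 < n ∧ ζ ^ n = 1}).map ι := ⟨⟨a, ha'⟩, hmem, rfl⟩
      rw [IntermediateField.adjoin_map] at h1
      refine IntermediateField.adjoin.mono ℚ _ _ ?_ h1
      rintro _ ⟨ζ, ⟨n, hn, hζ⟩, rfl⟩
      refine ⟨n, hn, ?_⟩
      have := congrArg ι hζ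
      rwa [map_pow, map_one] at this
    obtain ⟨ρ₀, hρU, hρa⟩ := exists_algEquiv_apply_ne ⟨a, ha'⟩ haU'
    obtain ⟨ψ, hψE, hψτ⟩ := exists_ringEquiv_extend ρ₀ hτ (ε := 1) (by norm_num)
    have hψτ' : ψ τ = τ := by rw [hψτ, map_one, one_mul]
    have hψU : ∀ (ζ : F) (n : ℕ), 0 < n → ζ ^ n = 1 → ψ ζ = ζ := by
      intro ζ n hn hζ
      have h1 := hψE ⟨ζ, hUalg ζ n hn hζ⟩
      have h2 : (⟨ζ, hUalg ζ n hn hζ⟩ : algebraicClosure ℚ F) ^ n = 1 := Subtype.ext (by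
        rw [SubmonoidClass.coe_pow]; exact hζ)
      rw [show ψ ζ = ψ ((⟨ζ, hUalg ζ n hn hζ⟩ : algebraicClosure ℚ F) : F) from rfl, h1,
        hρU _ n hn h2]
    -- `ψ` fixes `SK` pointwise
    have hψSK : ∀ x : fieldOf D, ψ x = x := by
      have hle : fieldOf D ≤ ringHomFixedField (ψ : F →+* F) := by
        refine IntermediateField.adjoin_le_iff.2 ?_
        rintro g (hg | ⟨x, hx, rfl⟩)
        · obtain ⟨q, rfl⟩ := Submodule.mem_span_singleton.1 hg
          show ψ (q • τ) = q • τ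
          rw [map_rat_smul, hψτ']
        · obtain ⟨q, rfl⟩ := Submodule.mem_span_singleton.1 hx
          exact hψU _ q.den q.den_pos (exp_smul_pow_den hexpτ q)
      intro x
      exact hle x.2
    have ha0 : a ≠ 0 := fun h => haU (h ▸ zero_mem _)
    have hγ := isGammaIso_single_of_ringEquiv hF.schanuelProperty hτ hexpτ ψ hψSK ha ha0
    have hiso : IsGammaIsoTw₂ (RingEquiv.refl (fieldOf D)) (Fin.append (Fin.elim0 : Fin 0 → F) ![a])
        (Fin.append (Fin.elim0 : Fin 0 → F) ![ψ a]) :=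
      hγ.trans_tw₂ (IsGammaIsoTw₂.refl D _)
    have ha'alg : IsAlgebraic ℚ (ψ a) := by
      let ψₐ : F ≃ₐ[ℚ] F := AlgEquiv.ofRingEquiv (f := ψ) fun q => by simp
      exact ha.algHom ψₐ.toAlgHom
    have ha0' : ψ a ≠ 0 := (map_ne_zero_iff ψ ψ.injective).2 ha0
    have hs : IsStrong (D ⊔ Submodule.span ℚ (range (Fin.append (Fin.elim0 : Fin 0 → F) ![a]))) := by
      rw [range_append_elim0_single]
      exact isStrong_sup_span_singleton_of_mem_acl hsD (mem_acl_of_isAlgebraic ha _)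
        (not_mem_span_singleton_of_isAlgebraic hτ ha ha0)
    have hs' : IsStrong (D ⊔ Submodule.span ℚ (range (Fin.append (Fin.elim0 : Fin 0 → F) ![ψ a]))) := by
      rw [range_append_elim0_single]
      exact isStrong_sup_span_singleton_of_mem_acl hsD (mem_acl_of_isAlgebraic ha'alg _)
        (not_mem_span_singleton_of_isAlgebraic hτ ha'alg ha0')
    obtain ⟨ρ, hρc, -⟩ := exists_equiv_of_isGammaIsoTw₂_of_countable hF hker hker hτ0 hτ0
      (IsEBaseIso₂.refl D) hiso hs hs'
    refine ⟨ρ, fun hfix => hρa (Subtype.ext ?_)⟩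
    have h1 := hρc (Fin.natAdd 0 0)
    rw [Fin.append_right, Fin.append_right] at h1
    change ρ a = ψ a at h1
    have h2 := hψE ⟨a, ha'⟩
    change ψ a = (ρ₀ ⟨a, ha'⟩ : F) at h2
    change (ρ₀ ⟨a, ha'⟩ : F) = a
    rw [← h2, ← h1, hfix]

end CountableCase

/-! ### Real abelian numbers and algebraicity along embeddings -/

section Transfer

variable {P : Type*} [Field P] [CharZero P] {F : Type u} [Field F] [CharZero F]

/-- Real abelian numbers are preserved by ring homomorphisms of fields of characteristic zero
(the image of `ℚ(ζ + ζ⁻¹)` is `ℚ(f ζ + (f ζ)⁻¹)`). [folklore] -/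
theorem _root_.Literature.ModelTheory.ExponentialFields.IsRealAbelian.map (f : P →+* F) {x : P}
    (hx : IsRealAbelian x) : IsRealAbelian (f x) := by
  obtain ⟨ζ, ⟨n, hn, hζ⟩, hmem⟩ := hx
  let fₐ : P →ₐ[ℚ] F := f.toRatAlgHom
  refine ⟨f ζ, ⟨n, hn, by rw [← map_pow, hζ, map_one]⟩, ?_⟩
  have h1 : f x ∈ (IntermediateField.adjoin ℚ ({ζ + ζ⁻¹} : Set P)).map fₐ := ⟨x, hmem, rfl⟩
  rw [IntermediateField.adjoin_map, Set.image_singleton] at h1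
  have h2 : fₐ (ζ + ζ⁻¹) = f ζ + (f ζ)⁻¹ := by
    change f (ζ + ζ⁻¹) = f ζ + (f ζ)⁻¹
    rw [map_add, map_inv₀]
  rwa [h2] at h1

/-- Algebraicity over `ℚ` descends along injective ring homomorphisms of fields of characteristic
zero. [folklore] -/
theorem isAlgebraic_of_ringHom (f : P →+* F) {x : P} (hx : IsAlgebraic ℚ (f x)) :
    IsAlgebraic ℚ x := by
  obtain ⟨p, hp0, hp⟩ := hx
  refine ⟨p, hp0, f.injective ?_⟩
  rw [map_zero]
  change f.toRatAlgHom (Polynomial.aeval x p) = 0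
  rw [← Polynomial.aeval_algHom_apply f.toRatAlgHom x p]
  exact hp

end Transfer

/-! ### Automorphisms of the prime model of an uncountable Zilber field in `Type` extend -/

section PrimeModel

open FirstOrder Literature.ModelTheory.Quasiminimal

/-- **Automorphisms of the prime model extend** (the §3.5 Proposition of KMO for `F₀` inside
`ecl(∅)`, uncountable case, in the form: every automorphism `θ` of the countable `ecl`-closed
E-subfield `ecl^K(∅)` of an uncountable Zilber field `K` in `Type` extends to an automorphism of
the exponential field `K`). Proof, from the tree's proof of Zilber's categoricity theorem: with
`P = ecl^K(∅)`, the field `K` carries the two base points `ι = incl` and `ι' = incl ∘ θ` onto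
`ecl^K(∅)`, giving two uncountable members of the quasiminimal pregeometry class
`ZilberClosedClassOver P` of the same cardinality, which are isomorphic
(`IsQuasiminimalPregeometryClass.nonempty_equiv_of_mk_eq'`: Kirby 2010 Thm 3.3 / Haykazyan 2016
Thm 16 with Bays–Kirby's verification of the class axioms); an isomorphism of
`Language.eclIsoOver P`-structures is an isomorphism of exponential fields and intertwines the
base points (apply it to the relation symbol of the pointed closure `(ecl(∅), p, ι)`), i.e. it
extends `θ`. (KMO §3.5: "The proposition follows from … [quasiminimal excellence] … together with
Theorem 3.3 of" Kirby 2010.) [cite: KirbyMacintyreOnshuus2012, §3.5 Proposition (proof sketch)]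
[cite: Kirby2010QMEC, Thm 3.3] [cite: Haykazyan2016, Theorem 16] -/
theorem exists_equiv_extend_eclEmpty₀ {K : Type} [Field K] [CharZero K] [ExponentialRing K]
    (hK : IsZilberField K) (hKu : ℵ₀ < #K)
    (θ : ExponentialRingEquiv (Khovanskii.eclSubfield (∅ : Set K))
      (Khovanskii.eclSubfield (∅ : Set K))) :
    ∃ ρ : ExponentialRingEquiv K K, ∀ x : Khovanskii.eclSubfield (∅ : Set K), ρ x = θ x := by
  classical
  haveI : Uncountable K := Cardinal.aleph0_lt_mk_iff.1 hKu
  let P : Type := Khovanskii.eclSubfield (∅ : Set K)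
  let ι₁ : ExponentialRingHom P K := Khovanskii.eclSubfield.eHom (∅ : Set K)
  let ι₂ : ExponentialRingHom P K := ι₁.comp θ.toExponentialRingHom
  let bp₁ : EclBasePoint P K := ⟨ι₁⟩
  let bp₂ : EclBasePoint P K := ⟨ι₂⟩
  let S₁ : (Language.eclIsoOver P).Structure K := @Language.eclIsoOver.instStructure P _ _ K _ _ bp₁
  let S₂ : (Language.eclIsoOver P).Structure K := @Language.eclIsoOver.instStructure P _ _ K _ _ bp₂
  have hι₁ : Set.range ι₁ = ecl (∅ : Set K) := by
    ext a
    constructor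
    · rintro ⟨p, rfl⟩; exact p.2
    · intro ha; exact ⟨⟨a, ha⟩, rfl⟩
  have hι₂ : Set.range ι₂ = ecl (∅ : Set K) := by
    ext a
    constructor
    · rintro ⟨p, rfl⟩; exact (θ p).2
    · intro ha
      refine ⟨θ.symm ⟨a, ha⟩, ?_⟩
      change ((θ (θ.symm ⟨a, ha⟩) : Khovanskii.eclSubfield (∅ : Set K)) : K) = a
      rw [θ.apply_symm_apply]
  have hH₁ : @ZilberClosedClassOver P _ _ K S₁ ecl :=
    @zilberClosedClassOver_of_isZilberField P _ _ K _ _ _ bp₁ hK hKu hι₁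
  have hH₂ : @ZilberClosedClassOver P _ _ K S₂ ecl :=
    @zilberClosedClassOver_of_isZilberField P _ _ K _ _ _ bp₂ hK hKu hι₂
  obtain ⟨e⟩ := @IsQuasiminimalPregeometryClass.nonempty_equiv_of_mk_eq' (Language.eclIsoOver P)
    (ZilberClosedClassOver P) K K S₁ S₂ ecl ecl
    (ZilberClosedClassOver.isQuasiminimalPregeometryClass (P := P)) hH₁ hH₂ inferInstance rfl
  refine ⟨@ExponentialRingEquiv.ofEclIsoOverEquiv P _ _ K K _ _ bp₁ _ _ bp₂ e, fun x => ?_⟩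
  change e (x : K) = (θ x : K)
  -- the relation symbol of the pointed prime model `(ecl(x), x, ι₁)` transported along `e`
  have hιecl : ∀ p : P, @basePt P _ _ K _ _ bp₁ p ∈ ecl (∅ : Set K) := fun p => p.2
  have h1 := @relMap_self_over P _ _ K _ _ bp₁ hιecl 1 ![(x : K)]
  have h2 := (@Language.Equiv.map_rel (Language.eclIsoOver P) K K S₁ S₂ e 1
    (@PointedEFieldOver.self P _ _ K _ _ bp₁ hιecl 1 ![(x : K)]) ![(x : K)]).2 h1
  obtain ⟨φ, -, hφpt, hφb⟩ := (@Language.eclIsoOver.relMap_iff P _ _ K _ _ bp₂ 1 _ _).1 h2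
  have h3 := congr_fun hφpt 0
  have h4 := hφb x
  simp only [Function.comp_apply, Matrix.cons_val_zero] at h3
  have h5 : (@PointedEFieldOver.self P _ _ K _ _ bp₁ hιecl 1 ![(x : K)]).pt 0 =
      (@PointedEFieldOver.self P _ _ K _ _ bp₁ hιecl 1 ![(x : K)]).base x := Subtype.ext rfl
  rw [h5, h4] at h3
  exact h3.symm

end PrimeModel

/-! ### KMO §3.7 in every universe, from the extension of automorphisms of the prime model -/

section Reduction

open Literature.ModelTheory.ExponentialFields.ExponentialRing

/-- **KMO 2012, §3.7 from the extension of automorphisms of prime models.** If in every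
uncountable Zilber field (in `Type u`) every automorphism of the exponential field `ecl(∅)`
extends to an automorphism of the field, then every algebraic number of a Zilber field in
`Type u` which is not real abelian is moved by an automorphism: countable fields are
`exists_equiv_apply_ne_of_countable`; in an uncountable Zilber field `F` the prime model
`ecl^F(∅)` is a countable Zilber field (`IsZilberField.eclSubfield_isZilberField`) containing the
algebraic numbers, so it has an automorphism moving `α`, which extends to `F`. (The hypothesis is
the uncountable case of KMO's §3.5 Proposition for subfields of `ecl(∅)`, proved for `Type` in
`exists_equiv_extend_eclEmpty₀`.) [cite: KirbyMacintyreOnshuus2012, §3.5 Proposition and §3.7] -/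
theorem exists_equiv_apply_ne_of_extend_eclEmpty
    (hE : ∀ (K : Type u) [Field K] [CharZero K] [ExponentialRing K], IsZilberField K → ℵ₀ < #K →
      ∀ θ : ExponentialRingEquiv (Khovanskii.eclSubfield (∅ : Set K))
        (Khovanskii.eclSubfield (∅ : Set K)),
        ∃ ρ : ExponentialRingEquiv K K, ∀ x : Khovanskii.eclSubfield (∅ : Set K), ρ x = θ x) :
    KMO2012_exists_equiv_apply_ne.{u} := by
  intro F _ _ _ hF a ha hna
  classical
  rcases le_or_gt #F ℵ₀ with hle | hlt
  · haveI : Countable F := Cardinal.mk_le_aleph0_iff.1 hle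
    exact exists_equiv_apply_ne_of_countable hF ha hna
  · -- uncountable: move `a` inside the prime model and extend
    have hP : IsZilberField (Khovanskii.eclSubfield (∅ : Set F)) := hF.eclSubfield_isZilberField ∅
    haveI : Countable (Khovanskii.eclSubfield (∅ : Set F)) :=
      (hF.hasCountableClosureProperty ∅ Set.countable_empty).to_subtype
    have haP : a ∈ ecl (∅ : Set F) := mem_ecl_empty_of_isAlgebraic ha
    set a₀ : Khovanskii.eclSubfield (∅ : Set F) := ⟨a, haP⟩ with ha₀def
    have ha₀ : IsAlgebraic ℚ a₀ :=
      isAlgebraic_of_ringHom (Khovanskii.eclSubfield (∅ : Set F)).subtype (x := a₀) ha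
    have hna₀ : ¬ IsRealAbelian a₀ := fun h =>
      hna (h.map (Khovanskii.eclSubfield (∅ : Set F)).subtype)
    obtain ⟨θ, hθ⟩ := exists_equiv_apply_ne_of_countable hP ha₀ hna₀
    obtain ⟨ρ, hρ⟩ := hE F hF hlt θ
    refine ⟨ρ, fun h => hθ (Subtype.ext ?_)⟩
    rw [← hρ a₀]
    exact h

/-- **KMO 2012, Theorem 2 (automorphism form, §3.7–3.8) for Zilber fields in `Type` — proved**:
`KMO2012_exists_equiv_apply_ne.{0}`. In particular, under Zilber's conjecture `IsZilberField ℂ`,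
every algebraic `α ∈ ℂ` with `α² ∉ ℚ^{ab} ∩ ℝ` is moved off `{α, -α}` by an automorphism of
`ℂ_exp` (`KMO2012_exists_equiv_apply_ne.complex` applied to this theorem).
[cite: KirbyMacintyreOnshuus2012, §3.7 (proof of Theorem 2) and §3.8] -/
theorem _root_.Literature.ModelTheory.ExponentialFields.KMO2012_exists_equiv_apply_ne_of_type_zero :
    KMO2012_exists_equiv_apply_ne.{0} :=
  exists_equiv_apply_ne_of_extend_eclEmpty.{0} fun _ _ _ _ hK hKu θ =>
    exists_equiv_extend_eclEmpty₀ hK hKu θ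

end Reduction

/-! ### Consequence for `ℂ_exp` under Zilber's conjecture -/

section Complex

/-- **Zilber's conjecture ⇒ prescribed Galois orbits are realised by automorphisms of `ℂ_exp`**
(KMO §3.7–3.8 transferred to `ℂ` through `IsZilberField ℂ`, now unconditionally in KMO's
theorem): for every algebraic `α ∈ ℂ` whose square is not both real and cyclotomic there is a
ring endomorphism of `ℂ` commuting with `exp` (an automorphism of `ℂ_exp`) moving `α` off
`{α, -α}` — `KMO2012_exists_equiv_apply_ne.complex` fed with the proved
`KMO2012_exists_equiv_apply_ne_of_type_zero`. [cite: KirbyMacintyreOnshuus2012, §3.7 and §3.8] -/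
theorem complex_of_isZilberField (hC : IsZilberField ℂ) {α : ℂ} (hα : IsAlgebraic ℚ α)
    (h2 : ¬ ((α ^ 2).im = 0 ∧ ∃ n : ℕ, 0 < n ∧
      α ^ 2 ∈ IntermediateField.adjoin ℚ ({Complex.exp (2 * Real.pi * Complex.I / n)} : Set ℂ))) :
    ∃ j : ℂ →+* ℂ, (∀ z : ℂ, j (Complex.exp z) = Complex.exp (j z)) ∧ j α ≠ α ∧ j α ≠ -α :=
  KMO2012_exists_equiv_apply_ne_of_type_zero.complex hC hα h2

end Complex

end KMO2012

end Literature.ModelTheory.ExponentialFields
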